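import Summits.Schanuel.Schanuel.Theorems.RootDecomp1BQuadFrame04

/-!
# RootDecomp1BQuadFrame — lens 4, generation 36 ADDENDUM «QUADRATIC FRAMES» (B-R23 (ii)(b)): the (1|ρ) At-cells and 5 ≤ polarDeg (1, ρ) for EVERY ρ ∈ `QuadHyperLiouville` (hyper-approximable by real quadratic irrationals) modulo `Roy2014_thm_1_1` ONLY, with the NAMED member ρ_Q = √2 + λ_H of FINITE irrationality exponent — continuation (RootDecomp1BQuadFrame05): §C the (1|ρ) cells for ρ ∈ QuadHyperLiouville mod hRoy (`five_le_polarDeg_one_of_quadHyper`, X(2), At-cells) + §N the cells at ρ_Q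

(lens-4 g36 ADDENDUM `QuadFrame.lean` [HOME/decomp-schanuel-lens-4/g36/ sha256 ffb0c3af…, 1516 l; NODE L1950 / REQUEST L1951; critic VERDICT L1957 (B-R23 (ii)(b) cell credit, RULE B-R24, port GO)]; port by census-1 gen 17 as
`RootDecomp1BQuadFrame01`–`05` — see the PORT NOTE of part 01; `--supports stmt-Schanuel-32406`; rung 0.)
-/

noncomputable section

open Complex IntermediateField MvPolynomial

namespace Summit.Schanuel.Schanuel.Theorems.RootDecomp1BQuadFrame

open Summit.Schanuel.Schanuel.Theorems.RootDecomp1EPointTransfer (Roy2014_thm_1_1)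
open Summit.Schanuel.Schanuel.Theorems.RootDecomp1KHyper (mvlen mvlen_nonneg abs_coeff_le_mvlen one_le_mvlen
  exists_ball_eval_ne_zero mvlen_add_le mvlen_sub_le mvlen_mul_le mvlen_C_mul_le mvlen_sum_le)
open Summit.Schanuel.Schanuel.Theorems.RootDecomp1BHyperFrame (royDeg royS RoyNF roy_tree_iff framePt Ff
  Ff_eq_aeval exists_lipschitz_Ff gcoef gcoef_ne_zero apply_zero_le_totalDegree engine_endgame
  trdeg_adjoin_le_of_isAlgebraic' linearIndependent_one_irrational)
open Summit.Schanuel.Schanuel.Theorems.RootDecomp1BFedFlagCore (KleinIH polarDeg polarField)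
open Summit.Schanuel.Schanuel.Theorems.RootDecomp1BDefectFloorDefs (SharpRelativeLindemannAt TameDefectZeroAt
  WildSharpDefectZeroAt WildSharpDefectZeroInitAt WildSharpInitAt)
open Summit.Schanuel.Schanuel.Theorems.RootDecomp1BDefectFloorCells (natCast_le_trdeg_of_algebraicIndependent)
open Summit.Schanuel.Schanuel.Theorems.RootDecomp1BRadicalDescent (exists_int_relation norm_mvaeval_le_mvlen)
open Summit.Schanuel.Schanuel.Theorems.RootDecomp1BMovingZero (mem_polarField_one mem_polarField_swap)

/-! ## §C  THE CELLS at `(1 | ρ)`, `ρ ∈ QuadHyperLiouville` — modulo Roy's theorem ONLY -/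

section Cells

/-- **`t(r) ≥ 5` (general polar field).**  For `ρ ∈ QuadHyperLiouville`, every real tuple `r` whose polar field
contains `ρ, e, e^i, e^ρ, e^{iρ}` has `t(r) ≥ 5` (mod `Roy2014_thm_1_1`). -/
theorem five_le_polarDeg_of_quadHyper (hRoy : Roy2014_thm_1_1) {ρ : ℝ} (hρ : QuadHyperLiouville ρ)
    {m : ℕ} {r : Fin m → ℝ} (hρr : (ρ : ℂ) ∈ polarField r) (he : cexp 1 ∈ polarField r)
    (hei : cexp Complex.I ∈ polarField r) (heρ : cexp ρ ∈ polarField r)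
    (heρi : cexp (ρ * Complex.I) ∈ polarField r) :
    ((5 : ℕ) : Cardinal) ≤ polarDeg r := by
  have hai := algebraicIndependent_cons_of_quadFrameMeasure (quadFrameMeasure_of_roy hRoy) hρ
  refine natCast_le_trdeg_of_algebraicIndependent (L := polarField r) hai fun i => ?_
  refine Fin.cases ?_ (fun j => ?_) i
  · simpa using hρr
  · simp only [Fin.cons_succ, qpt_apply]
    fin_cases j
    · simpa using he
    · simpa using heρ
    · simpa using hei
    · simpa using heρi

/-- **`t(1, ρ) ≥ 5` — THE FULL SCHANUEL VALUE of the column `(1 | ρ)`** for `ρ ∈ QuadHyperLiouville` (mod Roy):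
`ρ, e, e^ρ, e^i, e^{iρ}` are algebraically independent (and `5` is the maximum, `t(1, ρ) ≤ 5` trivially). -/
theorem five_le_polarDeg_one_of_quadHyper (hRoy : Roy2014_thm_1_1) {ρ : ℝ} (hρ : QuadHyperLiouville ρ) :
    ((5 : ℕ) : Cardinal) ≤ polarDeg ![(1 : ℝ), ρ] := by
  obtain ⟨h1, h2, h3, h4, h5⟩ := mem_polarField_one ρ
  exact five_le_polarDeg_of_quadHyper hRoy hρ h1 h2 h3 h4 h5

/-- … and for the swapped column `(ρ | 1)`. -/
theorem five_le_polarDeg_swap_of_quadHyper (hRoy : Roy2014_thm_1_1) {ρ : ℝ} (hρ : QuadHyperLiouville ρ) :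
    ((5 : ℕ) : Cardinal) ≤ polarDeg ![ρ, (1 : ℝ)] := by
  obtain ⟨h1, h2, h3, h4, h5⟩ := mem_polarField_swap ρ
  exact five_le_polarDeg_of_quadHyper hRoy hρ h1 h2 h3 h4 h5

/-- **X(2)(1, ρ)** — the storey-2 floor `t(1, ρ) ≥ 4` for `ρ ∈ QuadHyperLiouville` (mod Roy). -/
theorem four_le_polarDeg_one_of_quadHyper (hRoy : Roy2014_thm_1_1) {ρ : ℝ} (hρ : QuadHyperLiouville ρ) :
    ((2 + 2 : ℕ) : Cardinal) ≤ polarDeg ![(1 : ℝ), ρ] :=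
  (Nat.cast_le.2 (by norm_num)).trans (five_le_polarDeg_one_of_quadHyper hRoy hρ)

/-- `t(1, ρ) ≥ 3` (the weaker floor, for the SRL step instance). -/
theorem three_le_polarDeg_one_of_quadHyper (hRoy : Roy2014_thm_1_1) {ρ : ℝ} (hρ : QuadHyperLiouville ρ) :
    ((1 + 1 + 1 : ℕ) : Cardinal) ≤ polarDeg ![(1 : ℝ), ρ] :=
  (Nat.cast_le.2 (by norm_num)).trans (five_le_polarDeg_one_of_quadHyper hRoy hρ)

/-- The X(2) floor in the VERBATIM shape of the body of the 1B crux `KleinPolarSchanuel` (item 24622) at `m = 2`,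
`r = (1, ρ)` (`polarDeg` unfolded). -/
theorem kleinPolarSchanuel_body_two_one_quad (hRoy : Roy2014_thm_1_1) {ρ : ℝ} (hρ : QuadHyperLiouville ρ) :
    ((2 + 2 : ℕ) : Cardinal) ≤ Algebra.trdeg ℚ ↥(IntermediateField.adjoin ℚ
      (Set.range (Fin.append (fun j => ((![(1 : ℝ), ρ] j : ℝ) : ℂ)) (fun j => ((![(1 : ℝ), ρ] j : ℝ) : ℂ) * Complex.I)) ∪
        Set.range (Complex.exp ∘ Fin.append (fun j => ((![(1 : ℝ), ρ] j : ℝ) : ℂ))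
          (fun j => ((![(1 : ℝ), ρ] j : ℝ) : ℂ) * Complex.I)))) :=
  four_le_polarDeg_one_of_quadHyper hRoy hρ

/-- **SRLAt (1 | ρ)** — the sharp relative Lindemann step of item 32406 AT `(1 | ρ)`, `ρ ∈ QuadHyperLiouville`. -/
theorem sharpRelativeLindemannAt_one_quad (hRoy : Roy2014_thm_1_1) {ρ : ℝ} (hρ : QuadHyperLiouville ρ) :
    SharpRelativeLindemannAt 1 ![(1 : ℝ), ρ] :=
  fun _ _ _ => three_le_polarDeg_one_of_quadHyper hRoy hρ

/-- **T0At (1 | ρ)** — the tame defect-zero step of item 32407 AT `(1 | ρ)`, `ρ ∈ QuadHyperLiouville`. -/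
theorem tameDefectZeroAt_one_quad (hRoy : Roy2014_thm_1_1) {ρ : ℝ} (hρ : QuadHyperLiouville ρ) :
    TameDefectZeroAt 1 ![(1 : ℝ), ρ] :=
  fun _ _ _ _ => four_le_polarDeg_one_of_quadHyper hRoy hρ

/-- **W0At (1 | ρ)** — the wild sharp defect-zero step of item 32408 AT `(1 | ρ)`, `ρ ∈ QuadHyperLiouville`. -/
theorem wildSharpDefectZeroAt_one_quad (hRoy : Roy2014_thm_1_1) {ρ : ℝ} (hρ : QuadHyperLiouville ρ) :
    WildSharpDefectZeroAt 1 ![(1 : ℝ), ρ] :=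
  fun _ _ _ _ _ => four_le_polarDeg_one_of_quadHyper hRoy hρ

/-- **W0InitAt (1 | ρ)** — the init-form of the wild step AT `(1 | ρ)`, `ρ ∈ QuadHyperLiouville`. -/
theorem wildSharpDefectZeroInitAt_one_quad (hRoy : Roy2014_thm_1_1) {ρ : ℝ} (hρ : QuadHyperLiouville ρ) :
    WildSharpDefectZeroInitAt 1 ![(1 : ℝ), ρ] :=
  fun _ _ _ _ _ => four_le_polarDeg_one_of_quadHyper hRoy hρ

end Cells

/-! ## §N  THE CELLS AT THE NAMED MEMBER `ρ_Q = √2 + λ_H` (hypothesis-free except `Roy2014_thm_1_1`) -/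

section MemberCells

open Summit.Schanuel.Schanuel.Theorems.RootDecomp1KHyper.HyperCell (HyperLiouville)

/-- `ρ_Q` is irrational (from its finite-exponent lower bound: a rational has distance `0` to itself). -/
theorem irrational_rhoQ : Irrational rhoQ := by
  rw [irrational_iff_ne_rational]
  intro a b hb h
  wlog hpos : 0 < b generalizing a b
  · exact this (-a) (-b) (by omega) (by rw [h]; push_cast; rw [neg_div_neg_eq]) (by omega)
  obtain ⟨n, rfl⟩ : ∃ n : ℕ, b = n := ⟨b.toNat, (Int.toNat_of_nonneg hpos.le).symm⟩
  have hn0 : 0 < n := by exact_mod_cast hpos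
  have hge := abs_rhoQ_sub_rat_ge_pow a hn0
  simp only [Int.cast_natCast] at h
  rw [h, sub_self, abs_zero] at hge
  have : (0 : ℝ) < 1 / (64000 * (n : ℝ) ^ 10) := by positivity
  linarith

/-- `(1, ρ_Q)` is ℚ-free (the hypothesis of the live 1B cruxes at the column `(1 | ρ_Q)`). -/
theorem linearIndependent_one_rhoQ : LinearIndependent ℚ (![(1 : ℝ), rhoQ] : Fin 2 → ℝ) :=
  linearIndependent_one_irrational irrational_rhoQ

/-- **`ρ_Q, e, e^{ρ_Q}, e^i, e^{iρ_Q}` are algebraically independent** (mod Roy). -/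
theorem algebraicIndependent_rhoQ (hRoy : Roy2014_thm_1_1) :
    AlgebraicIndependent ℚ (Fin.cons (rhoQ : ℂ) (fun j => cexp (qpt rhoQ j)) : Fin 5 → ℂ) :=
  algebraicIndependent_cons_of_quadFrameMeasure (quadFrameMeasure_of_roy hRoy) quadHyperLiouville_rhoQ

/-- **`t(1, ρ_Q) = 5` (lower bound; `≤ 5` is trivial): the full Schanuel value at a NAMED real number of finite
irrationality exponent**, mod `Roy2014_thm_1_1` only. -/
theorem five_le_polarDeg_one_rhoQ (hRoy : Roy2014_thm_1_1) :
    ((5 : ℕ) : Cardinal) ≤ polarDeg ![(1 : ℝ), rhoQ] :=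
  five_le_polarDeg_one_of_quadHyper hRoy quadHyperLiouville_rhoQ

/-- `5 ≤ polarDeg (ρ_Q, 1)` (swapped ordering), mod Roy. -/
theorem five_le_polarDeg_swap_rhoQ (hRoy : Roy2014_thm_1_1) :
    ((5 : ℕ) : Cardinal) ≤ polarDeg ![rhoQ, (1 : ℝ)] :=
  five_le_polarDeg_swap_of_quadHyper hRoy quadHyperLiouville_rhoQ

/-- X(2)(1, ρ_Q). -/
theorem four_le_polarDeg_one_rhoQ (hRoy : Roy2014_thm_1_1) :
    ((2 + 2 : ℕ) : Cardinal) ≤ polarDeg ![(1 : ℝ), rhoQ] :=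
  four_le_polarDeg_one_of_quadHyper hRoy quadHyperLiouville_rhoQ

/-- The Klein–polar X(2) body at `(1, ρ_Q)`, mod Roy. -/
theorem kleinPolarSchanuel_body_two_one_rhoQ (hRoy : Roy2014_thm_1_1) :
    ((2 + 2 : ℕ) : Cardinal) ≤ Algebra.trdeg ℚ ↥(IntermediateField.adjoin ℚ
      (Set.range (Fin.append (fun j => ((![(1 : ℝ), rhoQ] j : ℝ) : ℂ)) (fun j => ((![(1 : ℝ), rhoQ] j : ℝ) : ℂ) * Complex.I)) ∪
        Set.range (Complex.exp ∘ Fin.append (fun j => ((![(1 : ℝ), rhoQ] j : ℝ) : ℂ))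
          (fun j => ((![(1 : ℝ), rhoQ] j : ℝ) : ℂ) * Complex.I)))) :=
  four_le_polarDeg_one_rhoQ hRoy

/-- `SharpRelativeLindemannAt 1` at `(1, ρ_Q)`, mod Roy. -/
theorem sharpRelativeLindemannAt_one_rhoQ (hRoy : Roy2014_thm_1_1) : SharpRelativeLindemannAt 1 ![(1 : ℝ), rhoQ] :=
  sharpRelativeLindemannAt_one_quad hRoy quadHyperLiouville_rhoQ

/-- `TameDefectZeroAt` at `(1, ρ_Q)`, mod Roy. -/
theorem tameDefectZeroAt_one_rhoQ (hRoy : Roy2014_thm_1_1) : TameDefectZeroAt 1 ![(1 : ℝ), rhoQ] :=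
  tameDefectZeroAt_one_quad hRoy quadHyperLiouville_rhoQ

/-- `WildSharpDefectZeroAt` at `(1, ρ_Q)`, mod Roy. -/
theorem wildSharpDefectZeroAt_one_rhoQ (hRoy : Roy2014_thm_1_1) : WildSharpDefectZeroAt 1 ![(1 : ℝ), rhoQ] :=
  wildSharpDefectZeroAt_one_quad hRoy quadHyperLiouville_rhoQ

/-- `WildSharpDefectZeroInitAt` at `(1, ρ_Q)`, mod Roy. -/
theorem wildSharpDefectZeroInitAt_one_rhoQ (hRoy : Roy2014_thm_1_1) :
    WildSharpDefectZeroInitAt 1 ![(1 : ℝ), rhoQ] :=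
  wildSharpDefectZeroInitAt_one_quad hRoy quadHyperLiouville_rhoQ

/-- **SEPARATION from every earlier `(1|ρ)`-cell of the campaign**: `ρ_Q` is in none of their classes. -/
theorem rhoQ_separation :
    QuadHyperLiouville rhoQ ∧ ¬ Liouville rhoQ ∧ ¬ HyperLiouville rhoQ ∧
      (∀ k, 3 ≤ k → ¬ Summit.Schanuel.Schanuel.Theorems.RootDecomp1KGeneric.LiouvilleOrder k rhoQ) ∧
      ¬ Summit.Schanuel.Schanuel.Theorems.RootDecomp1BRadicalDescent.UltraLiouville rhoQ :=
  ⟨quadHyperLiouville_rhoQ, not_liouville_rhoQ, not_hyperLiouville_rhoQ, fun _ hk => not_liouvilleOrder_rhoQ hk,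
    not_ultraLiouville_rhoQ⟩

end MemberCells

end Summit.Schanuel.Schanuel.Theorems.RootDecomp1BQuadFrame

end
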